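import Summits.AtomisticToContinuum.FouriersLaw.Theorems.LocalOhmBVLocalOhmStubSoftExtractionAux2
import Literature.MathematicalPhysics.KineticTheory.LangevinChainGibbs

/-!
# The level-`k` bound of the soft extraction (helper for `stub_softExtraction`)

Helper file for stub `stub_softExtraction` (S2c) of the birth line of crux `LocalOhmBV.LocalOhm`
(item stmt-AtomisticToContinuum-12009). The normalised level functional of the extraction is
`Λ_k(F) = (ρ_k(F_k) - θ_k(x_k) · Cov_{Gibbs_N}(F_k, H_N)/T²) / g_k`, `F_k = F ∘ embed N x_k`,
`g_k = d_k/(N-1)`. For a box observable `F = g ∘ boxRestrictAt a n` this file proves the REGULARITY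
bound at a single level (`level_bound`): from the interior a-priori estimate (A) at radius `n` and
the RE-CENTRED bulk centre `x_k + a`, the window–energy covariance bound (b3) and the violating
inequality `k · WV_{x_k}(k) < |g_k|`, one gets `|Λ_k(F)| ≤ (2|A(n)| + |C(n)|/T²) ‖F_k‖_{L²(Gibbs_N)}`
as soon as `k ≥ n + b(n) + |a| + 1`. Ingredients: the telescoping bound
`|θ(x_k + a) - θ(x_k)| ≤ WV_{x_k}(k)` (`abs_sub_le_windowVariation`), monotonicity of the window
variation in the window (`windowVariation_mono`) and the real-arithmetic core (`level_bound_arith`).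
Along a violating sequence `(N_k, d_k, θ_k, x_k)` this gives, for every `ε > 0`, EVENTUALLY in `k`,
`|Λ_k(g ∘ boxRestrictAt a n)| ≤ (2|A(n)| + |C(n)|/T²) · √(‖g ∘ box‖²_{L²(μ∞)} + ε)`
(`eventually_level_bound`), using the anchor-uniform thermodynamic limit (b4) for `g²` to transport the
`L²(Gibbs_{N_k})`-norm of the re-centred observable to the `L²(μ∞)`-norm; the constant depends on the
box size `n` only (translation-uniform regularity).
-/

set_option autoImplicit false

noncomputable section

namespace Summit.AtomisticToContinuum.FouriersLaw.Theorems.LocalOhmBirth.SoftExtraction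

open MeasureTheory Filter Topology
open scoped BigOperators
open Literature.MathematicalPhysics.KineticTheory.HeatConduction
open Summit.AtomisticToContinuum.FouriersLaw.Theorems.WindowLimit (embed)

/-! ### Real arithmetic core -/

/-- **Arithmetic of the level bound.** From `|ρ - θ'·V/T²| ≤ A s (|g| + Wₙ)` (the interior estimate
at the re-centred point), `Wₙ ≤ W_k`, `|θ' - θ₀| ≤ W_k` (re-centring), `k W_k < |g|` with `k ≥ 1`
(the violation) and `|V| ≤ C s` (covariance bound): `|(ρ - θ₀ V/T²)/g| ≤ (2|A| + |C|/T²) s`.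
[folklore] -/
theorem level_bound_arith {ρ θ' θ₀ V T A C g Wn Wk s : ℝ} {k : ℕ} (hT : 0 < T)
    (hA : |ρ - θ' * (V / T ^ 2)| ≤ A * s * (|g| + Wn))
    (hWn : Wn ≤ Wk) (hWn0 : 0 ≤ Wn) (hθ : |θ' - θ₀| ≤ Wk) (hviol : (k : ℝ) * Wk < |g|) (hk : 1 ≤ k)
    (hC : |V| ≤ C * s) (hs : 0 ≤ s) :
    |(ρ - θ₀ * (V / T ^ 2)) / g| ≤ (2 * |A| + |C| / T ^ 2) * s := by
  have hT2 : 0 < T ^ 2 := by positivity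
  have hWk0 : 0 ≤ Wk := hWn0.trans hWn
  have hk1 : (1 : ℝ) ≤ k := by exact_mod_cast hk
  have hWk : Wk < |g| := by nlinarith
  have hgpos : 0 < |g| := by linarith
  have h1 : |ρ - θ' * (V / T ^ 2)| ≤ |A| * s * (2 * |g|) := by
    calc |ρ - θ' * (V / T ^ 2)| ≤ A * s * (|g| + Wn) := hA
      _ ≤ |A| * s * (|g| + Wn) := by
          have : 0 ≤ s * (|g| + Wn) := by positivity
          nlinarith [le_abs_self A]
      _ ≤ |A| * s * (2 * |g|) := by
          have : 0 ≤ |A| * s := by positivity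
          nlinarith
  have h2 : |(θ' - θ₀) * (V / T ^ 2)| ≤ |g| * (|C| * s) / T ^ 2 := by
    rw [abs_mul, abs_div, abs_of_pos hT2]
    have hV : |V| ≤ |C| * s := hC.trans (by nlinarith [le_abs_self C])
    calc |θ' - θ₀| * (|V| / T ^ 2) ≤ |g| * (|C| * s / T ^ 2) :=
          mul_le_mul (hθ.trans hWk.le) (div_le_div_of_nonneg_right hV hT2.le) (by positivity)
            (abs_nonneg _)
      _ = |g| * (|C| * s) / T ^ 2 := by ring
  have h3 : |ρ - θ₀ * (V / T ^ 2)| ≤ |g| * ((2 * |A| + |C| / T ^ 2) * s) := by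
    have : ρ - θ₀ * (V / T ^ 2) = (ρ - θ' * (V / T ^ 2)) + (θ' - θ₀) * (V / T ^ 2) := by ring
    rw [this]
    refine (abs_add_le _ _).trans ?_
    calc |ρ - θ' * (V / T ^ 2)| + |(θ' - θ₀) * (V / T ^ 2)|
        ≤ |A| * s * (2 * |g|) + |g| * (|C| * s) / T ^ 2 := add_le_add h1 h2
      _ = |g| * ((2 * |A| + |C| / T ^ 2) * s) := by ring
  rw [abs_div, div_le_iff₀ hgpos]
  calc |ρ - θ₀ * (V / T ^ 2)| ≤ |g| * ((2 * |A| + |C| / T ^ 2) * s) := h3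
    _ = (2 * |A| + |C| / T ^ 2) * s * |g| := by ring

/-! ### The kinetic response profile: point values, window variation, telescoping -/

/-- The "value at `x`" sum `Σ_j [j = i] θ_j` is `θ_i`. [folklore] -/
theorem sum_ite_val_eq {N : ℕ} (θ : Fin N → ℝ) (i : Fin N) :
    (∑ j : Fin N, if j.val = i.val then θ j else 0) = θ i := by
  rw [Finset.sum_eq_single i (fun b _ hb => if_neg fun h => hb (Fin.ext h))
    (fun h => absurd (Finset.mem_univ i) h), if_pos rfl]

/-- **Monotonicity of the window variation in the window**: the variation of `θ` over the bonds of
the window of radius `n` about `x'` is at most that over the window of radius `k` about `x` when the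
former window lies in the latter. [folklore] -/
theorem windowVariation_mono {N : ℕ} (θ : Fin N → ℝ) {x x' n k : ℕ} (h1 : x + n ≤ x' + k)
    (h2 : x' + n ≤ x + k) :
    (∑ i : Fin N, ∑ j : Fin N,
        (if j.val = i.val + 1 ∧ x' ≤ i.val + n ∧ i.val ≤ x' + n then |θ j - θ i| else 0)) ≤
      ∑ i : Fin N, ∑ j : Fin N,
        (if j.val = i.val + 1 ∧ x ≤ i.val + k ∧ i.val ≤ x + k then |θ j - θ i| else 0) := by
  refine Finset.sum_le_sum fun i _ => Finset.sum_le_sum fun j _ => ?_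
  by_cases h : j.val = i.val + 1 ∧ x' ≤ i.val + n ∧ i.val ≤ x' + n
  · rw [if_pos h, if_pos ⟨h.1, by omega, by omega⟩]
  · rw [if_neg h]
    split_ifs <;> positivity

/-- The window variation is non-negative. [folklore] -/
theorem windowVariation_nonneg {N : ℕ} (θ : Fin N → ℝ) (x n : ℕ) :
    0 ≤ ∑ i : Fin N, ∑ j : Fin N,
        (if j.val = i.val + 1 ∧ x ≤ i.val + n ∧ i.val ≤ x + n then |θ j - θ i| else 0) :=
  Finset.sum_nonneg fun _ _ => Finset.sum_nonneg fun _ _ => by split_ifs <;> positivity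

/-- **Telescoping**: for sites `m ≤ p < N` inside the window of radius `k` about `x`, the difference
of the point values `θ(m) - θ(p)` is bounded by the window variation `WV_x(k)`. [folklore] -/
theorem abs_sub_le_windowVariation {N : ℕ} (θ : Fin N → ℝ) {x k m p : ℕ} (hmp : m ≤ p) (hp : p < N)
    (hm : x ≤ m + k) (hpk : p ≤ x + k) :
    |(∑ i : Fin N, if i.val = m then θ i else 0) - (∑ i : Fin N, if i.val = p then θ i else 0)| ≤
      ∑ i : Fin N, ∑ j : Fin N,
        (if j.val = i.val + 1 ∧ x ≤ i.val + k ∧ i.val ≤ x + k then |θ j - θ i| else 0) := by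
  set θ' : ℕ → ℝ := fun t => ∑ i : Fin N, if i.val = t then θ i else 0 with hθ'
  -- telescoping along `ℕ`
  have hA : |θ' m - θ' p| ≤ ∑ t ∈ Finset.Ico m p, |θ' t - θ' (t + 1)| := by
    have := dist_le_Ico_sum_dist θ' hmp
    simpa only [Real.dist_eq] using this
  -- the window variation as a sum over `range N`
  have hB : (∑ i : Fin N, ∑ j : Fin N,
      (if j.val = i.val + 1 ∧ x ≤ i.val + k ∧ i.val ≤ x + k then |θ j - θ i| else 0)) =
      ∑ t ∈ Finset.range N,
        (if t + 1 < N ∧ x ≤ t + k ∧ t ≤ x + k then |θ' t - θ' (t + 1)| else 0) := by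
    rw [← Fin.sum_univ_eq_sum_range
      (fun t => if t + 1 < N ∧ x ≤ t + k ∧ t ≤ x + k then |θ' t - θ' (t + 1)| else 0) N]
    refine Finset.sum_congr rfl fun i _ => ?_
    by_cases hi : i.val + 1 < N
    · rw [Finset.sum_eq_single (⟨i.val + 1, hi⟩ : Fin N) (fun b _ hb => if_neg fun h =>
        hb (Fin.ext h.1)) (fun h => absurd (Finset.mem_univ _) h)]
      by_cases hc : x ≤ i.val + k ∧ i.val ≤ x + k
      · rw [if_pos ⟨rfl, hc⟩, if_pos ⟨hi, hc⟩]
        have e1 : θ' i.val = θ i := sum_ite_val_eq θ i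
        have e2 : θ' (i.val + 1) = θ ⟨i.val + 1, hi⟩ := sum_ite_val_eq θ ⟨i.val + 1, hi⟩
        rw [e1, e2]
        exact abs_sub_comm _ _
      · rw [if_neg fun h => hc h.2, if_neg fun h => hc h.2]
    · rw [if_neg fun h => hi h.1]
      refine Finset.sum_eq_zero fun j _ => ?_
      have := j.isLt
      rw [if_neg fun h => by omega]
  rw [hB]
  refine hA.trans ?_
  have hsub : Finset.Ico m p ⊆ Finset.range N := fun t ht => by
    simp only [Finset.mem_Ico] at ht
    simp only [Finset.mem_range]
    omega
  calc ∑ t ∈ Finset.Ico m p, |θ' t - θ' (t + 1)|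
      = ∑ t ∈ Finset.Ico m p,
          (if t + 1 < N ∧ x ≤ t + k ∧ t ≤ x + k then |θ' t - θ' (t + 1)| else 0) := by
        refine Finset.sum_congr rfl fun t ht => ?_
        simp only [Finset.mem_Ico] at ht
        rw [if_pos ⟨by omega, by omega, by omega⟩]
    _ ≤ ∑ t ∈ Finset.range N,
          (if t + 1 < N ∧ x ≤ t + k ∧ t ≤ x + k then |θ' t - θ' (t + 1)| else 0) :=
        Finset.sum_le_sum_of_subset_of_nonneg hsub fun t _ _ => by split_ifs <;> positivity

/-- Re-centring: `|θ(x') - θ(x)| ≤ WV_x(k)` for two sites `x, x' < N` at distance `≤ k`. [folklore] -/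
theorem abs_centre_sub_le_windowVariation {N : ℕ} (θ : Fin N → ℝ) {x x' k : ℕ} (hx : x < N)
    (hx' : x' < N) (h1 : x ≤ x' + k) (h2 : x' ≤ x + k) :
    |(∑ i : Fin N, if i.val = x' then θ i else 0) - (∑ i : Fin N, if i.val = x then θ i else 0)| ≤
      ∑ i : Fin N, ∑ j : Fin N,
        (if j.val = i.val + 1 ∧ x ≤ i.val + k ∧ i.val ≤ x + k then |θ j - θ i| else 0) := by
  rcases le_total x' x with hle | hle
  · exact abs_sub_le_windowVariation θ hle hx (by omega) (by omega)
  · rw [abs_sub_comm]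
    exact abs_sub_le_windowVariation θ hle hx' (by omega) h2

/-! ### The level bound -/

/-- **Level bound.** At a single level (`N`, response coefficient `d`, profile `θ`, bulk centre
`x₀` at depth `k`), for a box profile `g` on `{a, …, a + n}`: the interior estimate (A) at radius
`n` (boundary width `b`, constant `A`) applied at the re-centred bulk centre `x₀ + a`, the identity
`μN T T = Gibbs_N`, the covariance bound (b3) with constant `C`, and the violating inequality give
`|(ρ - θ(x₀) Cov(F_k, H_N)/T²)/(d/(N-1))| ≤ (2|A| + |C|/T²) ‖F_k‖_{L²(Gibbs_N)}` for the response
limit `ρ` of the transported observable `F_k = g ∘ boxRestrictAt a n ∘ embed N x₀`, once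
`k ≥ n + b + |a| + 1`. [folklore] -/
theorem level_bound (P : OscillatorChain) {N : ℕ} (μN : ℝ → ℝ → Measure (PhaseSpace N)) {T : ℝ}
    (hT : 0 < T) (d : ℝ) (θ : Fin N → ℝ) (x₀ k n b : ℕ) (A C : ℝ) (a : ℤ)
    (g : (Fin (n + 1) → ℝ × ℝ) → ℝ) (hg : Continuous g)
    (hgb : ∃ (C₀ : ℝ) (m : ℕ), ∀ y, |g y| ≤ C₀ * (1 + ‖y‖) ^ m)
    (hA : ∀ x : ℕ, b + n ≤ x → x + n + b + 2 ≤ N →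
      ∀ ψ : PhaseSpace N → ℝ, Continuous ψ →
        (∀ z z' : PhaseSpace N, (∀ i : Fin N, x ≤ i.val + n → i.val ≤ x + n + 1 →
          z.1 i = z'.1 i ∧ z.2 i = z'.2 i) → ψ z = ψ z') →
        (∃ (C₀ : ℝ) (m : ℕ), ∀ z, |ψ z| ≤ C₀ * (1 + ‖z‖) ^ m) →
        ∀ ρ : ℝ, Tendsto (fun δ : ℝ => ((∫ z, ψ z ∂(μN (T + δ / 2) (T - δ / 2))) -
          ∫ z, ψ z ∂(μN T T)) / δ) (𝓝[≠] 0) (𝓝 ρ) →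
        |ρ - (∑ i : Fin N, if i.val = x then θ i else 0) *
            (((∫ z, ψ z * P.hamiltonian N z ∂(μN T T)) -
              (∫ z, ψ z ∂(μN T T)) * (∫ z, P.hamiltonian N z ∂(μN T T))) / T ^ 2)| ≤
          A * Real.sqrt (∫ z, (ψ z) ^ 2 ∂(μN T T)) *
            (|d| / ((N : ℝ) - 1) + ∑ i : Fin N, ∑ j : Fin N,
              (if j.val = i.val + 1 ∧ x ≤ i.val + n ∧ i.val ≤ x + n then |θ j - θ i| else 0)))
    (ha1 : μN T T = P.gibbsMeasure N T)
    (hb3 : |(∫ z, g (boxRestrictAt a n (embed N x₀ z)) * P.hamiltonian N z ∂(P.gibbsMeasure N T)) -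
          (∫ z, g (boxRestrictAt a n (embed N x₀ z)) ∂(P.gibbsMeasure N T)) *
            (∫ z, P.hamiltonian N z ∂(P.gibbsMeasure N T))| ≤
        C * Real.sqrt (∫ z, (g (boxRestrictAt a n (embed N x₀ z))) ^ 2 ∂(P.gibbsMeasure N T)))
    {ρ : ℝ} (hρ : Tendsto (fun δ : ℝ =>
      ((∫ z, g (boxRestrictAt a n (embed N x₀ z)) ∂(μN (T + δ / 2) (T - δ / 2))) -
        ∫ z, g (boxRestrictAt a n (embed N x₀ z)) ∂(μN T T)) / δ) (𝓝[≠] 0) (𝓝 ρ))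
    (hk₁ : k ≤ x₀) (hk₂ : x₀ + k + 2 ≤ N)
    (hviol : (k : ℝ) * ∑ i : Fin N, ∑ j : Fin N,
        (if j.val = i.val + 1 ∧ x₀ ≤ i.val + k ∧ i.val ≤ x₀ + k then |θ j - θ i| else 0) <
      |d| / ((N : ℝ) - 1))
    (hK : n + b + a.natAbs + 1 ≤ k) :
    |(ρ - (∑ i : Fin N, if i.val = x₀ then θ i else 0) *
        (((∫ z, g (boxRestrictAt a n (embed N x₀ z)) * P.hamiltonian N z ∂(P.gibbsMeasure N T)) -
          (∫ z, g (boxRestrictAt a n (embed N x₀ z)) ∂(P.gibbsMeasure N T)) *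
            (∫ z, P.hamiltonian N z ∂(P.gibbsMeasure N T))) / T ^ 2)) / (d / ((N : ℝ) - 1))| ≤
      (2 * |A| + |C| / T ^ 2) *
        Real.sqrt (∫ z, (g (boxRestrictAt a n (embed N x₀ z))) ^ 2 ∂(P.gibbsMeasure N T)) := by
  obtain ⟨C₀, m, hC₀⟩ := hgb
  -- the re-centred bulk centre `x' = x₀ + a`
  obtain ⟨x', hx'⟩ : ∃ x' : ℕ, (x' : ℤ) = x₀ + a := ⟨(x₀ + a).toNat, by omega⟩
  have hx'1 : b + n ≤ x' := by omega
  have hx'2 : x' + n + b + 2 ≤ N := by omega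
  -- the interior estimate at `x'` for the transported observable
  have hwin : ∀ z z' : PhaseSpace N, (∀ i : Fin N, x' ≤ i.val + n → i.val ≤ x' + n + 1 →
      z.1 i = z'.1 i ∧ z.2 i = z'.2 i) →
      g (boxRestrictAt a n (embed N x₀ z)) = g (boxRestrictAt a n (embed N x₀ z')) := by
    intro z z' h
    rw [boxRestrictAt_embed_eq_of_agree x' n (by omega) (by omega) z z' h]
  have hAx := hA x' hx'1 hx'2 (fun z => g (boxRestrictAt a n (embed N x₀ z)))
    (continuous_comp_boxRestrictAt_embed a n hg) hwin
    ⟨C₀, m, fun z => polyBound_comp_boxRestrictAt_embed a n hC₀ z⟩ ρ hρ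
  rw [ha1] at hAx
  -- `|d|/(N-1) = |d/(N-1)|`
  have hN1 : (0 : ℝ) < (N : ℝ) - 1 := by
    have : (2 : ℝ) ≤ N := by exact_mod_cast (by omega : 2 ≤ N)
    linarith
  have habs : |d| / ((N : ℝ) - 1) = |d / ((N : ℝ) - 1)| := by rw [abs_div, abs_of_pos hN1]
  rw [habs] at hAx hviol
  -- the pieces of the arithmetic core
  have hWn := windowVariation_mono θ (x := x₀) (x' := x') (n := n) (k := k) (by omega) (by omega)
  have hθ := abs_centre_sub_le_windowVariation θ (x := x₀) (x' := x') (k := k) (by omega) (by omega)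
    (by omega) (by omega)
  exact level_bound_arith hT hAx hWn (windowVariation_nonneg θ x' n) hθ hviol (by omega) hb3
    (Real.sqrt_nonneg _)

/-! ### Eventual regularity bound along the violating sequence -/

/-- **Eventual regularity bound of the level functionals** along a violating sequence, uniformly in
the position of the box. [folklore] -/
theorem eventually_level_bound :
    ∀ (P : OscillatorChain) (μ : (N : ℕ) → ℝ → ℝ → Measure (PhaseSpace N)) {T : ℝ}, 0 < T →
    ∀ (n b : ℕ) (A C : ℝ),
    (∀ (N : ℕ) (d : ℝ) (θ : Fin N → ℝ),
      Tendsto (fun δ : ℝ => P.totalCurrent (μ N (T + δ / 2) (T - δ / 2)) / δ) (𝓝[≠] 0) (𝓝 d) →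
      (∀ i : Fin N, Tendsto (fun δ : ℝ => ((∫ x, (x.2 i) ^ 2 ∂(μ N (T + δ / 2) (T - δ / 2))) -
        ∫ x, (x.2 i) ^ 2 ∂(μ N T T)) / δ) (𝓝[≠] 0) (𝓝 (θ i))) →
      ∀ x : ℕ, b + n ≤ x → x + n + b + 2 ≤ N →
      ∀ ψ : PhaseSpace N → ℝ, Continuous ψ →
        (∀ z z' : PhaseSpace N, (∀ i : Fin N, x ≤ i.val + n → i.val ≤ x + n + 1 →
          z.1 i = z'.1 i ∧ z.2 i = z'.2 i) → ψ z = ψ z') →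
        (∃ (C₀ : ℝ) (m : ℕ), ∀ z, |ψ z| ≤ C₀ * (1 + ‖z‖) ^ m) →
        ∀ ρ : ℝ, Tendsto (fun δ : ℝ => ((∫ z, ψ z ∂(μ N (T + δ / 2) (T - δ / 2))) -
          ∫ z, ψ z ∂(μ N T T)) / δ) (𝓝[≠] 0) (𝓝 ρ) →
        |ρ - (∑ i : Fin N, if i.val = x then θ i else 0) *
            (((∫ z, ψ z * P.hamiltonian N z ∂(μ N T T)) -
              (∫ z, ψ z ∂(μ N T T)) * (∫ z, P.hamiltonian N z ∂(μ N T T))) / T ^ 2)| ≤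
          A * Real.sqrt (∫ z, (ψ z) ^ 2 ∂(μ N T T)) *
            (|d| / ((N : ℝ) - 1) + ∑ i : Fin N, ∑ j : Fin N,
              (if j.val = i.val + 1 ∧ x ≤ i.val + n ∧ i.val ≤ x + n then |θ j - θ i| else 0))) →
    (∀ N : ℕ, 3 ≤ N → μ N T T = P.gibbsMeasure N T) →
    (∀ N : ℕ, 3 ≤ N → ∀ ψ : PhaseSpace N → ℝ, Continuous ψ →
        (∃ (C₀ : ℝ) (m : ℕ), ∀ z, |ψ z| ≤ C₀ * (1 + ‖z‖) ^ m) →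
        ∃ ρ : ℝ, Tendsto (fun δ : ℝ => ((∫ z, ψ z ∂(μ N (T + δ / 2) (T - δ / 2))) -
          ∫ z, ψ z ∂(μ N T T)) / δ) (𝓝[≠] 0) (𝓝 ρ)) →
    (∀ (N c : ℕ) (a : ℤ), 0 ≤ a + c → a + c + n < N →
      ∀ g : (Fin (n + 1) → ℝ × ℝ) → ℝ, Continuous g →
      (∃ (C₀ : ℝ) (m : ℕ), ∀ y, |g y| ≤ C₀ * (1 + ‖y‖) ^ m) →
      |(∫ z, g (boxRestrictAt a n (embed N c z)) * P.hamiltonian N z ∂(P.gibbsMeasure N T)) -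
          (∫ z, g (boxRestrictAt a n (embed N c z)) ∂(P.gibbsMeasure N T)) *
            (∫ z, P.hamiltonian N z ∂(P.gibbsMeasure N T))| ≤
        C * Real.sqrt (∫ z, (g (boxRestrictAt a n (embed N c z))) ^ 2 ∂(P.gibbsMeasure N T))) →
    ∀ {μinf : Measure ChainConfig},
    (∀ (n : ℕ) (g : (Fin (n + 1) → ℝ × ℝ) → ℝ), Continuous g →
      (∃ (C₀ : ℝ) (m : ℕ), ∀ y, |g y| ≤ C₀ * (1 + ‖y‖) ^ m) →
      ∀ ε : ℝ, 0 < ε → ∃ L N₀ : ℕ, ∀ (N c : ℕ) (a : ℤ), N₀ ≤ N → (L : ℤ) ≤ a + c →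
        a + c + n + L < N →
        |(∫ z, g (boxRestrictAt a n (embed N c z)) ∂(P.gibbsMeasure N T)) -
            ∫ σ, g (boxRestrictAt a n σ) ∂μinf| ≤ ε) →
    ∀ (Nk : ℕ → ℕ) (dk : ℕ → ℝ) (θk : (k : ℕ) → Fin (Nk k) → ℝ) (xk : ℕ → ℕ),
    (∀ k : ℕ, Tendsto (fun δ : ℝ =>
        P.totalCurrent (μ (Nk k) (T + δ / 2) (T - δ / 2)) / δ) (𝓝[≠] 0) (𝓝 (dk k))) →
    (∀ (k : ℕ) (i : Fin (Nk k)), Tendsto (fun δ : ℝ =>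
        ((∫ x, (x.2 i) ^ 2 ∂(μ (Nk k) (T + δ / 2) (T - δ / 2))) - ∫ x, (x.2 i) ^ 2 ∂(μ (Nk k) T T)) /
          δ) (𝓝[≠] 0) (𝓝 (θk k i))) →
    (∀ k : ℕ, k ≤ xk k) → (∀ k : ℕ, xk k + k + 2 ≤ Nk k) →
    (∀ k : ℕ, (k : ℝ) * ∑ i : Fin (Nk k), ∑ j : Fin (Nk k),
        (if j.val = i.val + 1 ∧ xk k ≤ i.val + k ∧ i.val ≤ xk k + k then |θk k j - θk k i| else 0) <
      |dk k| / ((Nk k : ℝ) - 1)) →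
    ∀ (a : ℤ) (g : (Fin (n + 1) → ℝ × ℝ) → ℝ), Continuous g →
    (∃ (C₀ : ℝ) (m : ℕ), ∀ y, |g y| ≤ C₀ * (1 + ‖y‖) ^ m) → ∀ ε : ℝ, 0 < ε →
    ∀ᶠ k in atTop,
      |(limUnder (𝓝[≠] (0 : ℝ)) (fun δ : ℝ =>
            ((∫ z, g (boxRestrictAt a n (embed (Nk k) (xk k) z)) ∂(μ (Nk k) (T + δ / 2) (T - δ / 2))) -
              ∫ z, g (boxRestrictAt a n (embed (Nk k) (xk k) z)) ∂(μ (Nk k) T T)) / δ) -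
          (∑ i : Fin (Nk k), if i.val = xk k then θk k i else 0) *
            (((∫ z, g (boxRestrictAt a n (embed (Nk k) (xk k) z)) * P.hamiltonian (Nk k) z
                ∂(P.gibbsMeasure (Nk k) T)) -
              (∫ z, g (boxRestrictAt a n (embed (Nk k) (xk k) z)) ∂(P.gibbsMeasure (Nk k) T)) *
                (∫ z, P.hamiltonian (Nk k) z ∂(P.gibbsMeasure (Nk k) T))) / T ^ 2)) /
          (dk k / ((Nk k : ℝ) - 1))| ≤
        (2 * |A| + |C| / T ^ 2) * Real.sqrt ((∫ σ, (g (boxRestrictAt a n σ)) ^ 2 ∂μinf) + ε) := by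
  intro P μ T hT n b A C hA ha1 ha2 hb3 μinf hb4 Nk dk θk xk hD hΘ hx₁ hx₂ hlt a g hg hgb ε hε
  obtain ⟨C₀, m, hC₀⟩ := hgb
  -- the thermodynamic limit (b4) for `g²`
  have hg2 : Continuous fun y => (g y) ^ 2 := hg.pow 2
  have hg2b : ∃ (C₁ : ℝ) (m₁ : ℕ), ∀ y, |(g y) ^ 2| ≤ C₁ * (1 + ‖y‖) ^ m₁ := by
    refine ⟨C₀ ^ 2, 2 * m, fun y => ?_⟩
    rw [abs_pow]
    calc |g y| ^ 2 ≤ (C₀ * (1 + ‖y‖) ^ m) ^ 2 := pow_le_pow_left₀ (abs_nonneg _) (hC₀ y) 2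
      _ = C₀ ^ 2 * (1 + ‖y‖) ^ (2 * m) := by ring
  obtain ⟨L, N₀, hb4'⟩ := hb4 n (fun y => (g y) ^ 2) hg2 hg2b ε hε
  filter_upwards [eventually_ge_atTop (n + b + a.natAbs + N₀ + L + 3)] with k hk
  have hxk := hx₁ k
  have hNk := hx₂ k
  have hN3 : 3 ≤ Nk k := by omega
  -- the response limit of the transported observable exists
  have hcont := continuous_comp_boxRestrictAt_embed (N := Nk k) (c := xk k) a n hg
  have hbd : ∃ (C₁ : ℝ) (m₁ : ℕ), ∀ z : PhaseSpace (Nk k),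
      |g (boxRestrictAt a n (embed (Nk k) (xk k) z))| ≤ C₁ * (1 + ‖z‖) ^ m₁ :=
    ⟨C₀, m, fun z => polyBound_comp_boxRestrictAt_embed a n hC₀ z⟩
  have hρ := tendsto_nhds_limUnder (ha2 (Nk k) hN3 _ hcont hbd)
  -- the single-level bound
  have hlev := level_bound P (μ (Nk k)) hT (dk k) (θk k) (xk k) k n b A C a g hg ⟨C₀, m, hC₀⟩
    (hA (Nk k) (dk k) (θk k) (hD k) (hΘ k)) (ha1 (Nk k) hN3)
    (hb3 (Nk k) (xk k) a (by omega) (by omega) g hg ⟨C₀, m, hC₀⟩) hρ hxk hNk (hlt k) (by omega)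
  refine hlev.trans (mul_le_mul_of_nonneg_left (Real.sqrt_le_sqrt ?_) (by positivity))
  -- transport of the `L²`-norm by (b4)
  have h4 : |(∫ z, (g (boxRestrictAt a n (embed (Nk k) (xk k) z))) ^ 2 ∂(P.gibbsMeasure (Nk k) T)) -
      ∫ σ, (g (boxRestrictAt a n σ)) ^ 2 ∂μinf| ≤ ε :=
    hb4' (Nk k) (xk k) a (by omega) (by omega) (by omega)
  linarith [(abs_sub_le_iff.1 h4).1]

end Summit.AtomisticToContinuum.FouriersLaw.Theorems.LocalOhmBirth.SoftExtraction

end
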